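import Literature.AlgebraicGeometry.Motives.HodgeStructureEndAlgEigenspaces
import HarnessLib

/-!
# Galois conjugates of the eigenvalues of a rational endomorphism: `dim Eig_{ρμ}(a_ℂ) = dim Eig_μ(a_ℂ)` for `ρ ∈ Aut(ℂ)`;
# eigenspaces and traces in an adapted basis; `tr Θ = 0` (Hodge symmetry) (Deligne 1982, I §3; van Geemen 2008, §2)

Family `hodge`, layer `Literature/AlgebraicGeometry/Motives`.  THEOREMS ONLY (no definition, no named fact).  Written for the
cell `pub-hodgecm2` (COR-CM), seat `b27` gen 55 (count-neutral Mumford–Tate-rank ladder, «the centre», part 2).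

For a finite-dimensional `ℚ`-vector space `V`, a rational endomorphism `a` and `ρ ∈ Aut(ℂ)`, the `ρ`-semilinear map
`ρ ⊗ 1 : ℂ ⊗ V → ℂ ⊗ V` commutes with `a_ℂ` and carries the eigenspace `Eig_μ(a_ℂ)` onto `Eig_{ρμ}(a_ℂ)` (Deligne, LNM 900, I §3,
Prop. 3.4 «defined over `ℚ`»: `σ ∈ Aut(ℂ)` acts on `V ⊗ ℂ` through the coefficients; van Geemen 2008, §2: the eigenspaces `V_σ`
of a rational `F`-action are permuted by the Galois group).  Hence:
* `rTensor_mem_eigenspace_baseChange` — `(ρ ⊗ 1) Eig_μ(a_ℂ) ⊆ Eig_{ρμ}(a_ℂ)`;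
* **`finrank_eigenspace_baseChange_conj_eq`** — `dim_ℂ Eig_{ρμ}(a_ℂ) = dim_ℂ Eig_μ(a_ℂ)` (a `ρ`-semilinear bijection; Mathlib's
  `rank_eq_of_equiv_equiv`, as for complex conjugation in `Motives/HodgeStructureEndAlgEigenspaces`);
* `eigenspace_eq_span_of_basis`, `finrank_eigenspace_eq_card_of_basis` — for a basis `(e_k)` of a module with `e_k ∈ Eig_{wt k}(f)`,
  `Eig_μ(f) = span {e_k | wt k = μ}` and `dim Eig_μ(f) = #{k | wt k = μ}`; **`card_filter_conj_eq`** — so `#{k | wt k = ρμ} = #{k | wt k = μ}`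
  for the complexification of a rational `a`: the multiset of eigenvalues is `Aut(ℂ)`-stable with constant multiplicity on orbits;
* `trace_eq_sum_repr_diag` — `tr Y = Σ_k e^*_k(Y e_k)`; `trace_eq_sum_of_diag` — `tr D = Σ_k d_k` for `D e_k = d_k e_k`;
* **`sum_two_mul_deg_sub_eq_zero`** — HODGE SYMMETRY in an adapted basis: for a Hodge structure `H` of weight `n` and a basis
  `e_k ∈ Eig_{wt k}(a_ℂ) ∩ V^{deg k, n − deg k}` counting the blocks (`#{(wt, deg) = (μ, p)} = dim (Eig_μ ∩ V^{p,n−p})`, the tree's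
  `exists_basis_mem_eigenspace_inf_piece`), `Σ_k (2 deg k − n) = 0`, i.e. `tr Θ = 0` for the Hodge operator `Θ = 2p − n` on `V^{p,n−p}`
  (`dim (Eig_μ ∩ V^{p,q}) = dim (Eig_μ̄ ∩ V^{q,p})`, `finrank_eigenspace_inf_piece_eq`).

## References
* [Deligne1982HodgeCycles] P. Deligne, *Hodge cycles on abelian varieties*, LNM 900 (1982), I §3 Prop. 3.4 and its proof.
  [cite: Deligne1982HodgeCycles, I §3 Prop. 3.4]
* [vanGeemen2008RealMultK3] B. van Geemen, Michigan Math. J. 56 (2008), §2 (eigenspaces of a rational field action).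
  [cite: vanGeemen2008RealMultK3, §2]
* [DeligneHodgeII1971] P. Deligne, *Théorie de Hodge II*, Publ. Math. IHÉS 40 (1971), 1.2.5, 2.1.x (Hodge symmetry `h^{p,q} = h^{q,p}`).
  [cite: DeligneHodgeII1971, 1.2.5]
-/

noncomputable section

open scoped TensorProduct

namespace Literature.AlgebraicGeometry.Motives

namespace HodgeStructure

universe u

variable {V : Type u} [AddCommGroup V] [Module ℚ V]

/-! ### §1 `ρ ⊗ 1` and the eigenspaces of a rational endomorphism -/

/-- `(ρ ⊗ 1)(c ⊗ v) = ρ c ⊗ v`. [cite: Deligne1982HodgeCycles, I §3 Prop. 3.4] -/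
theorem rTensor_ringEquiv_tmul (ρ : ℂ ≃+* ℂ) (c : ℂ) (v : V) :
    (ρ.toRingHom.toRatAlgHom.toLinearMap.rTensor V) (c ⊗ₜ[ℚ] v) = ρ c ⊗ₜ[ℚ] v := by
  rw [LinearMap.rTensor_tmul]; rfl

/-- `ρ ⊗ 1` is `ρ`-semilinear. [cite: Deligne1982HodgeCycles, I §3 Prop. 3.4] -/
theorem rTensor_ringEquiv_smul (ρ : ℂ ≃+* ℂ) (c : ℂ) (x : ℂ ⊗[ℚ] V) :
    (ρ.toRingHom.toRatAlgHom.toLinearMap.rTensor V) (c • x) = ρ c • (ρ.toRingHom.toRatAlgHom.toLinearMap.rTensor V) x := by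
  induction x using TensorProduct.induction_on with
  | zero => simp
  | tmul d v => rw [TensorProduct.smul_tmul', rTensor_ringEquiv_tmul, rTensor_ringEquiv_tmul, TensorProduct.smul_tmul',
      smul_eq_mul, smul_eq_mul, map_mul]
  | add x y hx hy => rw [smul_add, map_add, map_add, hx, hy, smul_add]

/-- `(ρ⁻¹ ⊗ 1) ∘ (ρ ⊗ 1) = id`. [cite: Deligne1982HodgeCycles, I §3 Prop. 3.4] -/
theorem rTensor_ringEquiv_symm_apply (ρ : ℂ ≃+* ℂ) (x : ℂ ⊗[ℚ] V) :
    (ρ.symm.toRingHom.toRatAlgHom.toLinearMap.rTensor V) ((ρ.toRingHom.toRatAlgHom.toLinearMap.rTensor V) x) = x := by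
  induction x using TensorProduct.induction_on with
  | zero => simp
  | tmul c v => rw [rTensor_ringEquiv_tmul, rTensor_ringEquiv_tmul, RingEquiv.symm_apply_apply]
  | add x y hx hy => rw [map_add, map_add, hx, hy]

/-- `ρ ⊗ 1` commutes with the complexification of a rational endomorphism: `(ρ ⊗ 1)(a_ℂ x) = a_ℂ ((ρ ⊗ 1) x)`.
[cite: Deligne1982HodgeCycles, I §3 Prop. 3.4] -/
theorem rTensor_ringEquiv_baseChange (ρ : ℂ ≃+* ℂ) (a : Module.End ℚ V) (x : ℂ ⊗[ℚ] V) :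
    (ρ.toRingHom.toRatAlgHom.toLinearMap.rTensor V) (a.baseChange ℂ x) =
      a.baseChange ℂ ((ρ.toRingHom.toRatAlgHom.toLinearMap.rTensor V) x) := by
  induction x using TensorProduct.induction_on with
  | zero => simp
  | tmul c v => rw [LinearMap.baseChange_tmul, rTensor_ringEquiv_tmul, rTensor_ringEquiv_tmul, LinearMap.baseChange_tmul]
  | add x y hx hy => simp only [map_add, hx, hy]

/-- **`(ρ ⊗ 1) Eig_μ(a_ℂ) ⊆ Eig_{ρμ}(a_ℂ)`**: the Galois conjugate of an eigenvector of a RATIONAL endomorphism is an eigenvector for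
the conjugate eigenvalue. [cite: vanGeemen2008RealMultK3, §2] [cite: Deligne1982HodgeCycles, I §3 Prop. 3.4] -/
theorem rTensor_mem_eigenspace_baseChange (ρ : ℂ ≃+* ℂ) (a : Module.End ℚ V) {μ : ℂ} {x : ℂ ⊗[ℚ] V}
    (hx : x ∈ Module.End.eigenspace (a.baseChange ℂ) μ) :
    (ρ.toRingHom.toRatAlgHom.toLinearMap.rTensor V) x ∈ Module.End.eigenspace (a.baseChange ℂ) (ρ μ) := by
  rw [Module.End.mem_eigenspace_iff] at hx ⊢
  rw [← rTensor_ringEquiv_baseChange, hx, rTensor_ringEquiv_smul]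

/-- **`dim_ℂ Eig_{ρμ}(a_ℂ) = dim_ℂ Eig_μ(a_ℂ)`** for a rational endomorphism `a` and `ρ ∈ Aut(ℂ)`: `ρ ⊗ 1` is a `ρ`-semilinear
bijection between the two eigenspaces. [cite: vanGeemen2008RealMultK3, §2] [cite: Deligne1982HodgeCycles, I §3 Prop. 3.4] -/
theorem finrank_eigenspace_baseChange_conj_eq [Module.Finite ℚ V] (ρ : ℂ ≃+* ℂ) (a : Module.End ℚ V) (μ : ℂ) :
    Module.finrank ℂ ↥(Module.End.eigenspace (a.baseChange ℂ) (ρ μ)) =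
      Module.finrank ℂ ↥(Module.End.eigenspace (a.baseChange ℂ) μ) := by
  set A := Module.End.eigenspace (a.baseChange ℂ) μ with hA
  set B := Module.End.eigenspace (a.baseChange ℂ) (ρ μ) with hB
  set f := ρ.toRingHom.toRatAlgHom.toLinearMap.rTensor V with hf
  set g := ρ.symm.toRingHom.toRatAlgHom.toLinearMap.rTensor V with hg
  have hAB : ∀ x ∈ A, f x ∈ B := fun x hx => rTensor_mem_eigenspace_baseChange ρ a hx
  have hBA : ∀ x ∈ B, g x ∈ A := fun x hx => by
    have h := rTensor_mem_eigenspace_baseChange ρ.symm a hx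
    rwa [RingEquiv.symm_apply_apply] at h
  have hgf : ∀ x, g (f x) = x := fun x => rTensor_ringEquiv_symm_apply ρ x
  have hfg : ∀ x, f (g x) = x := fun x => by
    have h := rTensor_ringEquiv_symm_apply ρ.symm x
    rwa [RingEquiv.symm_symm] at h
  set φ : A ≃+ B :=
    { toFun := fun x => ⟨f x.1, hAB x x.2⟩
      invFun := fun x => ⟨g x.1, hBA x x.2⟩
      left_inv := fun x => by ext; exact hgf x.1
      right_inv := fun x => by ext; exact hfg x.1
      map_add' := fun x y => by ext; simp [map_add] } with hφ
  have hφsmul : ∀ (c : ℂ) (x : A), φ (c • x) = ρ c • φ x := fun c x => by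
    apply Subtype.ext
    exact rTensor_ringEquiv_smul ρ c x.1
  unfold Module.finrank
  rw [rank_eq_of_equiv_equiv ρ φ ρ.bijective hφsmul]

/-! ### §2 Eigenspaces and traces in an adapted basis -/

section AdaptedBasis

variable {M : Type*} [AddCommGroup M] [Module ℂ M] {ι : Type*} [Fintype ι]

/-- For a basis `(e_k)` with `e_k ∈ Eig_{wt k}(f)`: **`Eig_μ(f) = span {e_k | wt k = μ}`** (the eigenspaces are independent, so the
off-block coordinates of an eigenvector vanish, `coord_eq_zero_of_mem_of_ne`). [cite: vanGeemen2008RealMultK3, §2] -/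
theorem eigenspace_eq_span_of_basis (e : Module.Basis ι ℂ M) (f : Module.End ℂ M) (wt : ι → ℂ)
    (he : ∀ k, e k ∈ Module.End.eigenspace f (wt k)) (μ : ℂ) :
    Module.End.eigenspace f μ = Submodule.span ℂ (e '' {k | wt k = μ}) := by
  classical
  apply le_antisymm
  · intro x hx
    rw [Module.Basis.mem_span_image]
    intro k hk
    by_contra hne
    rw [Finset.mem_coe, Finsupp.mem_support_iff] at hk
    exact hk (coord_eq_zero_of_mem_of_ne e wt (fun ν => Module.End.eigenspace f ν) f.eigenspaces_iSupIndep he hx hne)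
  · rw [Submodule.span_le]
    rintro _ ⟨k, hk, rfl⟩
    rw [Set.mem_setOf_eq] at hk
    rw [← hk]
    exact he k

/-- **`dim Eig_μ(f) = #{k | wt k = μ}`** for a basis `(e_k)` with `e_k ∈ Eig_{wt k}(f)`. [cite: vanGeemen2008RealMultK3, §2] -/
theorem finrank_eigenspace_eq_card_of_basis (e : Module.Basis ι ℂ M) (f : Module.End ℂ M) (wt : ι → ℂ)
    (he : ∀ k, e k ∈ Module.End.eigenspace f (wt k)) (μ : ℂ) :
    Module.finrank ℂ ↥(Module.End.eigenspace f μ) = (Finset.univ.filter fun k => wt k = μ).card := by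
  classical
  rw [eigenspace_eq_span_of_basis e f wt he μ]
  have hrange : e '' {k | wt k = μ} = Set.range fun k : {k // wt k = μ} => e k.1 := by
    ext x
    simp only [Set.mem_image, Set.mem_setOf_eq, Set.mem_range, Subtype.exists, exists_prop]
  have hli : LinearIndependent ℂ fun k : {k // wt k = μ} => e k.1 := e.linearIndependent.comp _ Subtype.val_injective
  rw [hrange, finrank_span_eq_card hli, Fintype.card_subtype]

/-- **The multiset of eigenvalues of a rational endomorphism is `Aut(ℂ)`-stable with constant multiplicities on orbits**:
for a basis `e_k ∈ Eig_{wt k}(a_ℂ)` of `V_ℂ`, `#{k | wt k = ρ μ} = #{k | wt k = μ}`. [cite: vanGeemen2008RealMultK3, §2]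
[cite: Deligne1982HodgeCycles, I §3 Prop. 3.4] -/
theorem card_filter_conj_eq [Module.Finite ℚ V] (e : Module.Basis ι ℂ (ℂ ⊗[ℚ] V)) (a : Module.End ℚ V) (wt : ι → ℂ)
    (he : ∀ k, e k ∈ Module.End.eigenspace (a.baseChange ℂ) (wt k)) (ρ : ℂ ≃+* ℂ) (μ : ℂ) :
    (Finset.univ.filter fun k => wt k = ρ μ).card = (Finset.univ.filter fun k => wt k = μ).card := by
  rw [← finrank_eigenspace_eq_card_of_basis e _ wt he, ← finrank_eigenspace_eq_card_of_basis e _ wt he,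
    finrank_eigenspace_baseChange_conj_eq]

/-- `tr Y = Σ_k e^*_k (Y e_k)` (the trace is the sum of the diagonal matrix coefficients). [cite: DeligneHodgeII1971, 1.2.5] -/
theorem trace_eq_sum_repr_diag (e : Module.Basis ι ℂ M) (Y : Module.End ℂ M) :
    LinearMap.trace ℂ M Y = ∑ k, e.repr (Y (e k)) k := by
  classical
  rw [LinearMap.trace_eq_matrix_trace ℂ e Y, Matrix.trace]
  refine Finset.sum_congr rfl fun k _ => ?_
  rw [Matrix.diag_apply, LinearMap.toMatrix_apply]

/-- `tr D = Σ_k d_k` for an operator diagonal in the basis, `D e_k = d_k e_k`. [cite: DeligneHodgeII1971, 1.2.5] -/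
theorem trace_eq_sum_of_diag (e : Module.Basis ι ℂ M) {D : Module.End ℂ M} {d : ι → ℂ} (hD : ∀ k, D (e k) = d k • e k) :
    LinearMap.trace ℂ M D = ∑ k, d k := by
  classical
  rw [trace_eq_sum_repr_diag e D]
  refine Finset.sum_congr rfl fun k _ => ?_
  rw [hD, map_smul, Finsupp.smul_apply, e.repr_self, Finsupp.single_eq_same, smul_eq_mul, mul_one]

end AdaptedBasis

/-! ### §3 Hodge symmetry in an adapted basis: `tr Θ = 0` -/

variable {n : ℤ}

/-- **`Σ_k (2 deg k − n) = 0`** for a basis `e_k ∈ Eig_{wt k}(a_ℂ) ∩ V^{deg k, n − deg k}` of `V_ℂ` which counts the blocks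
(`#{k | (wt k, deg k) = (μ, p)} = dim (Eig_μ(a_ℂ) ∩ V^{p,n−p})`, as produced by `exists_basis_mem_eigenspace_inf_piece`): the trace
of the Hodge operator `Θ` (`2p − n` on `V^{p,n−p}`) vanishes — HODGE SYMMETRY `dim (Eig_μ ∩ V^{p,q}) = dim (Eig_μ̄ ∩ V^{q,p})`
pairs the block `(μ, p)` with `(μ̄, n − p)`, of opposite `Θ`-weight. [cite: DeligneHodgeII1971, 1.2.5] [cite: vanGeemen2008RealMultK3, §2] -/
theorem sum_two_mul_deg_sub_eq_zero [Module.Finite ℚ V] (H : HodgeStructure V n) (a : Module.End ℚ V) {N : ℕ}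
    (wt : Fin N → ℂ) (deg : Fin N → ℤ)
    (hcount : ∀ (μ : ℂ) (p : ℤ), (Finset.univ.filter fun k => wt k = μ ∧ deg k = p).card =
      Module.finrank ℂ ↥(Module.End.eigenspace (a.baseChange ℂ) μ ⊓ H.piece p (n - p))) :
    ∑ k, (2 * deg k - n) = 0 := by
  -- regroup by the block label `l = (wt k, deg k)`
  set lab : Fin N → ℂ × ℤ := fun k => (wt k, deg k) with hlab
  have hc : ∀ l : ℂ × ℤ, (Finset.univ.filter fun k => lab k = l).card =
      Module.finrank ℂ ↥(Module.End.eigenspace (a.baseChange ℂ) l.1 ⊓ H.piece l.2 (n - l.2)) := by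
    intro l
    have hfilter : (Finset.univ.filter fun k => lab k = l) = Finset.univ.filter fun k => wt k = l.1 ∧ deg k = l.2 := by
      ext k
      simp only [Finset.mem_filter, Finset.mem_univ, true_and, hlab, Prod.ext_iff]
    rw [hfilter, hcount]
  have hregroup : ∑ k, (2 * deg k - n) =
      ∑ l ∈ Finset.univ.image lab, ((Finset.univ.filter fun k => lab k = l).card : ℤ) * (2 * l.2 - n) := by
    rw [show (∑ k, (2 * deg k - n)) = ∑ k ∈ Finset.univ, (fun l : ℂ × ℤ => 2 * l.2 - n) (lab k) from rfl]
    rw [Finset.sum_comp (fun l : ℂ × ℤ => 2 * l.2 - n) lab]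
    refine Finset.sum_congr rfl fun l _ => ?_
    rw [nsmul_eq_mul]
  rw [hregroup]
  -- the involution `(μ, p) ↦ (μ̄, n − p)`
  have hcg : ∀ l : ℂ × ℤ, (Finset.univ.filter fun k => lab k = (starRingEnd ℂ l.1, n - l.2)).card =
      (Finset.univ.filter fun k => lab k = l).card := by
    intro l
    rw [hc, hc]
    dsimp only
    rw [show n - (n - l.2) = l.2 by ring]
    exact (finrank_eigenspace_inf_piece_eq H a l.1 l.2 (n - l.2)).symm
  have hmem : ∀ l ∈ Finset.univ.image lab, (starRingEnd ℂ l.1, n - l.2) ∈ Finset.univ.image lab := by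
    intro l hl
    have hpos : 0 < (Finset.univ.filter fun k => lab k = l).card := by
      rw [Finset.mem_image] at hl
      obtain ⟨k, -, hk⟩ := hl
      exact Finset.card_pos.2 ⟨k, Finset.mem_filter.2 ⟨Finset.mem_univ _, hk⟩⟩
    rw [← hcg] at hpos
    obtain ⟨k, hk⟩ := Finset.card_pos.1 hpos
    rw [Finset.mem_filter] at hk
    rw [Finset.mem_image]
    exact ⟨k, Finset.mem_univ _, hk.2⟩
  refine Finset.sum_involution (fun l _ => (starRingEnd ℂ l.1, n - l.2)) ?_ ?_ hmem ?_
  · intro l _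
    rw [hcg]
    dsimp only
    ring
  · intro l _ hne heq
    apply hne
    have h2 : n - l.2 = l.2 := (Prod.ext_iff.1 heq).2
    have h2' : 2 * l.2 - n = 0 := by omega
    rw [h2', mul_zero]
  · intro l _
    ext <;> simp

end HodgeStructure

end Literature.AlgebraicGeometry.Motives

end
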